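import Summits.BirchSwinnertonDyer.Rank1Residual.Supersingular.BlindPointLever
import Literature.NumberTheory.EllipticCurves.QuadraticTwist
import HarnessLib

/-!
# (α3) TYPED — the blind-point PACKAGE at `p = 2`: signed Euler characteristic, signed interpolation and a 2-descent
# certificate at the ORDER-2 CHARACTER of `Γ`, as three hypothesis PREDICATES on the tree's `SignedDatum W 2`, and the
# bookkeeping 'package ⇒ blind certificate ⇒ (with ONE divisibility) BSD(E,2)' in analytic rank 0
# (cell `b2b-bsdres`, O1 sub-cell `p = 2`; lens-1 GEN 10 packet `G10_BlindControl.lean` §1–§3, ported by cc-typer-4 GEN 6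
# as typer item (27⁗) of o1 lead ruling R-G23.4 (g))

HONEST FRAMING (run/shared/lean/b2b/bsd-rank1-residual/, verbatim in every file): the goal of the cell is to DELETE
the COMBINATION-SHAPED residual classes of the Birch–Swinnerton-Dyer formula for ALL analytic-rank `≤ 1` elliptic
curves over `ℚ` — "full BSD formula for every rank `≤ 1` curve in class `C`" assembled STRICTLY from published
theorems — so that the rank-`≤ 1` remainder becomes exactly the CONSTRUCTION-SHAPED classes, which are TYPED
(missing-input `Prop`s), NOT attempted. This is not "finishing BSD". This file contains hypothesis PREDICATES (three
definitions with bodies, each a `Prop`-valued function of explicit data — NOT named facts, nothing is claimed to hold)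
and kernel-checked BOOKKEEPING theorems over the sign-agnostic `SignedDatum W 2` (`Supersingular/SignedRankZero.lean`,
p206397) and the blind-point lever (`Supersingular/BlindPointLever.lean`, p289031) with EVERY input an explicit
hypothesis — nothing about any curve, Selmer group or `L`-function is asserted; nothing booked; no RESIDUAL-MAP mark
moves. Research-route packaging (R-L1-G10-B "(α♭) the typed ♭-door", `cells/o1/ROUTES-O1.md` §lens-1 GEN 10 (G10.1);
o1 lead C173 R-G23.4 (a) register line, (g) typer item (27⁗) OPTIONAL, "reach-neutral until a ♭-divisibility exists";
refuter docket v3.12 (13) grades the SHAPE — is `e` a free datum, is (C₋₂) the right cut, is rank-0-only `hL`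
acceptable): the door's UNPRINTED inputs are unchanged in number and are exactly the binders of §3 — one signed
divisibility at `2`, the trivial-character readings (K)/(P) with `2 ∤ c`, and the ORDER-2-CHARACTER reading (K₋₂),
for which NO printed statement exists at `p = 2` (printed shapes are odd-`p` or trivial-character: Kim 2013, Sprung 2017,
Kobayashi 2003 Thm. 9.3; see the lens-1 block G10.4 / G10.6 for the labelled null searches).

CREDIT. This file is §1–§3 of the o1 lens-1 GEN 10 packet `HOME/b2b-bsdres-o1-idea-1-g10/lean/G10_BlindControl.lean`
(planner-b2b-bsdres-o1-idea-1-g10-0, 2026-08-21T16:23Z; source sha16 `f8aaf39f99956712`), ported VERBATIM up to: this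
paragraph; the sub-namespace (`LensOneG10` ↦ `BlindLever`, so that the lever's `evalAt` of p289031 is the ONE evaluation
map — the packet's §0 was a verbatim copy of that lever and is replaced by the import); and §3, whose proof is now the
two-line composition '§2 ⇒ certificate ⇒ `bsdp_two_of_oneDivisibility_of_blindCertificate`' instead of a re-proof.  The
packet's §4 (the ♭ value law at `a₂ = ±2` FORCED from 9b + packet B with `e = 2`) stays folder-side while 9b is a
DERIVATION (lead R-G23.4 (g)), and is not ported.

WHAT (α3) IS.  The lever (`BlindPointLever.lean`) turns ONE divisibility `L ∣ ξ` (or `ξ ∣ L`) in `Λ = ℤ₂⟦T⟧` plus the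
BLIND CERTIFICATE `L(−2) ≠ 0 ∧ ‖ξ(−2)‖₂ = ‖L(−2)‖₂` at the second fixed point `T = −2` of `ι` (the character `γ ↦ −1`
of `Γ`, i.e. the layer `ℚ(√2)`; `‖−2‖₂ = ½ < 1`) into `(ξ) = (L)`, whence `BSD(E,2)` in analytic rank `0` by the tree's
rank-0 chain.  (α3) is the ARITHMETIC CONTENT of that certificate, split into three binders of distinct provenance, each
a predicate in the style of the tree's `SignedDatum.EulerCharacteristic` / `SignedDatum.Interpolation`:

* `(K₋₂)` `SignedDatum.BlindEulerCharacteristicAt D Wd e` — THE CRUX (Iwasawa theory; unwritten at `p = 2`): for a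
  `ℚ`-model `Wd` of the quadratic twist `E^{(2)}` (`E^{(2)} ≅ E` over `ℚ(√2)`, the field cut out by the order-2
  character), IF `Sel_{2^∞}(E^{(2)}/ℚ)` is finite THEN `ξ(−2) = u · 2^e · 2^{v₂ ∏c_ℓ(E^{(2)})} · #Sel_{2^∞}(E^{(2)}/ℚ)`
  with `u ∈ ℤ₂^×` — the Euler-characteristic formula read at the character of order `2` instead of the trivial one
  (`#X/(T+2)X` against the `2^∞`-Selmer group of the twist; `E^{(2)}(ℚ)[2] = E(ℚ)[2] = 0` on the habitat, so no
  torsion term), with an EXPLICIT blind index `e : ℕ` (datum — the local index of the signed condition at the prime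
  `√2` above `2`, ramified in `ℚ(√2)`, and the non-integral idempotent `(1 − γ)/2`; conjecturally `e = 2` for the
  ♭-pair at `a₂ = ±2` (lens-1 P-G9-E); `e = 1` for the ♯-pair, all `a₂`);
* `(P₋₂)` `SignedDatum.BlindInterpolation D S e` — the VALUE LAW (classical side): `L(−2) = u′ · 2^e · S` with `S ∈ ℚ`
  the modular-symbol number `[1/8]⁺_E − [5/8]⁺_E` (tree: `ratPlusSymbol`): for the ♯-function `L♯(−2) = −2S` is the
  tree theorem `Supersingular.tsum_sharp_neg_two_eq_symbols` (packet B, p285534) — `e = 1`, `u′ = −1`; for the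
  ♭-function at `a₂ = ±2`, `w(E ⊗ χ₈) = +1`, the lens-1 9b derivation `5·L♭(−2) = −a₂·L♯(−2)` gives
  `L♭(−2) = (2a₂/5)·S` — `e = 2`, `u′ = ±1/5` (DERIVATION grade; folder-side §4 of the packet);
* `(C₋₂)` `BlindDescentCertificate Wd S` — the PER-CURVE CERTIFICATE (computable by 2-descent on `E^{(2)}`, conductor
  `64N`): `Sel_{2^∞}(E^{(2)}/ℚ)` finite, `S ≠ 0`, and `v₂(S) = v₂ ∏c_ℓ(E^{(2)}) + v₂ #Sel_{2^∞}(E^{(2)}/ℚ)` — on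
  instrument rows with `rank E^{(2)} = 0 ∧ Ш(E^{(2)})[2] = 0` this is `v₂(S) = v₂ Tam(E^{(2)})`, the lens-1 G7 law T2
  (re-scored EXACTLY 1 287 / 1 287 rank-0 twists in G10.2; EVIDENCE, not used here).

§2 `blindCertificate_of_package`: `(K₋₂) ∧ (P₋₂) ∧ (C₋₂)` with the SAME index `e` ⇒ the blind certificate.  §3
`bsdp_two_of_oneDivisibility_of_blindControl`: over the tree's `SignedDatum W 2` with its rank-0 readings at `T = 0`
((K) `EulerCharacteristic`, (P) `Interpolation`, `2 ∤ c` — met by the ♭-PAIR ONLY: Sprung's trivial-character constants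
`c♭ ∈ {1, −7, 1}` odd vs `c♯ ∈ {2, 6, −4}` even [corpus:paper:arxiv-1601.00010 p0017, table after Cor. 4.11]; lens-1 9e /
refuter v12a §81 (ii)), `E[2]` irreducible, GZK, `L(E,1) ≠ 0` (ANALYTIC RANK 0 ONLY — refuter v12a §81, lead C173 (a):
the 3 rank-1 habitat rows are OUT): ONE divisibility + the (α3)-package ⇒ `BSDp W 2`.  WHY IT MIGHT FAIL (the crux, one
line, lens-1): at `p = 2` the ♭/♯ local condition at `√2` evaluated at the order-2 character need not cut out
`E^{(2)}(ℚ₂) ⊗ ℚ₂/ℤ₂` exactly and `X` may have a non-zero finite submodule — either changes `e` or makes it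
curve-dependent, and then (K₋₂) with a constant `e` is false (refutable on the instrument: lens-1 P-G9-E).

References (shape only; nothing asserted): B. D. Kim, *The plus/minus Selmer groups for supersingular primes*,
J. Aust. Math. Soc. 95 (2013) Thm 1.2 / Cor 3.15, as quoted in A. Ray, F. Sprung, Ann. Inst. Fourier (2025) §1.2
p. 2343 [RaySprung2025]; F. Sprung, ANT 11 (2017) Cor 4.4, table p. 17 [Sprung2017]; S. Kobayashi, Invent. Math. 152
(2003) Thm 1.2, Thm 9.3 (control) [Kobayashi2003]; R. Greenberg, LNM 1716 (1999) p. 181 (the two fixed points of `ι`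
at `p = 2`) [GreenbergLNM1716].
-/

set_option autoImplicit false

open PowerSeries

namespace Summit.BirchSwinnertonDyer.Rank1Residual.Supersingular

namespace BlindLever

/-! ## §1. (α3): the blind-point package — three PREDICATES (nothing asserted) -/

section Package

open WeierstrassCurve Literature.NumberTheory.EllipticCurves

variable {W : WeierstrassCurve ℚ}

/-- **(K₋₂) THE CRUX (α3): the signed Euler characteristic at the ORDER-2 CHARACTER, as a predicate on the datum.**
For `Wd` a `ℚ`-model of the quadratic twist `W^{(2)}` (hypothesis `∃ C, C • W.quadraticTwist 2 = Wd`; the tree's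
`tamagawaProduct` and `selmerGroupPInfty` are model-independent, so no minimality is required): if
`Sel_{2^∞}(E^{(2)}/ℚ)` is finite then `ξ(−2) = u · 2^e · 2^{v₂ ∏c_ℓ(E^{(2)})} · #Sel_{2^∞}(E^{(2)}/ℚ)`, `u ∈ ℤ₂^×`,
with an explicit BLIND INDEX `e : ℕ` (datum).  Intended instance: `ξ = ξ♭` (char. power series of Sprung's
`X♭(E/ℚ_∞)`), `a₂ = ±2`, `e = 2` (lens-1 P-G9-E); or `ξ = ξ♯`, `e = 1`.  Unwritten at `p = 2`; a hypothesis
predicate, nothing asserted.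
[cite: RaySprung2025, §1.2 (p. 2343) (shape only — the trivial-character formula; nothing asserted)]
[cite: Kobayashi2003, Thm. 9.3 (shape only — control at finite layers, odd p; nothing asserted)] -/
def _root_.Summit.BirchSwinnertonDyer.Rank1Residual.Supersingular.SignedDatum.BlindEulerCharacteristicAt
    (D : SignedDatum W 2) (Wd : WeierstrassCurve ℚ) (e : ℕ) : Prop :=
  (∃ C : VariableChange ℚ, C • W.quadraticTwist 2 = Wd) → Finite (Wd.selmerGroupPInfty 2) →
    ∃ u : ℤ_[2]ˣ, ((evalAt (-2 : ℤ_[2]) D.xi : ℤ_[2]) : ℚ_[2]) =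
      ((u : ℤ_[2]) : ℚ_[2]) * (2 : ℚ_[2]) ^ e * (2 : ℚ_[2]) ^ (padicValNat 2 Wd.tamagawaProduct) *
        (Nat.card (Wd.selmerGroupPInfty 2) : ℚ_[2])

/-- **(P₋₂) the BLIND VALUE LAW, as a predicate on the datum**: `L(−2) = u′ · 2^e · S` with `u′ ∈ ℤ₂^×` and `S ∈ ℚ`
(intended: `S = [1/8]⁺_E − [5/8]⁺_E`; ♯: `e = 1`, `u′ = −1` — tree theorem `tsum_sharp_neg_two_eq_symbols`; ♭ at
`a₂ = ±2`, `w(E ⊗ χ₈) = +1`: `e = 2`, `u′ = ±1/5` by the lens-1 GEN 9b derivation).  A hypothesis predicate, nothing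
asserted. [cite: Sprung2017, Cor. 4.4 and §1.1 (shape only; nothing asserted)] -/
def _root_.Summit.BirchSwinnertonDyer.Rank1Residual.Supersingular.SignedDatum.BlindInterpolation
    (D : SignedDatum W 2) (S : ℚ) (e : ℕ) : Prop :=
  ∃ u : ℤ_[2]ˣ, ((evalAt (-2 : ℤ_[2]) D.L : ℤ_[2]) : ℚ_[2]) =
    ((u : ℤ_[2]) : ℚ_[2]) * (2 : ℚ_[2]) ^ e * ((S : ℚ) : ℚ_[2])

/-- **(C₋₂) the 2-DESCENT CERTIFICATE on the twist** (per curve, computable): `Sel_{2^∞}(E^{(2)}/ℚ)` is finite,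
`S ≠ 0`, and `v₂(S) = v₂ ∏c_ℓ(E^{(2)}) + v₂ #Sel_{2^∞}(E^{(2)}/ℚ)` (on rows with `rank E^{(2)} = 0`,
`Ш(E^{(2)})[2] = 0`: `#Sel = 1` and the clause is `v₂(S) = v₂ Tam(E^{(2)})` — the lens-1 G7 law T2, EVIDENCE).
A hypothesis predicate, nothing asserted. [cite: Sprung2017, §1.1 (shape only; nothing asserted)] -/
def BlindDescentCertificate (Wd : WeierstrassCurve ℚ) (S : ℚ) : Prop :=
  Finite (Wd.selmerGroupPInfty 2) ∧ S ≠ 0 ∧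
    padicValRat 2 S =
      (padicValNat 2 Wd.tamagawaProduct : ℤ) + (padicValNat 2 (Nat.card (Wd.selmerGroupPInfty 2)) : ℤ)

/-- Unfolding lemma for (C₋₂). [folklore] -/
theorem blindDescentCertificate_iff (Wd : WeierstrassCurve ℚ) (S : ℚ) :
    BlindDescentCertificate Wd S ↔
      Finite (Wd.selmerGroupPInfty 2) ∧ S ≠ 0 ∧
        padicValRat 2 S =
          (padicValNat 2 Wd.tamagawaProduct : ℤ) + (padicValNat 2 (Nat.card (Wd.selmerGroupPInfty 2)) : ℤ) :=
  Iff.rfl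

/-! ## §2. The package gives the blind certificate -/

/-- Norms on `ℤ₂ ⊂ ℚ₂` from valuations: two non-zero `2`-adic integers with equal valuation have equal norm.
[folklore] -/
theorem norm_eq_norm_of_coe_valuation_eq {x y : ℤ_[2]} (hx : ((x : ℤ_[2]) : ℚ_[2]) ≠ 0)
    (hy : ((y : ℤ_[2]) : ℚ_[2]) ≠ 0)
    (h : ((x : ℤ_[2]) : ℚ_[2]).valuation = ((y : ℤ_[2]) : ℚ_[2]).valuation) : ‖x‖ = ‖y‖ := by
  rw [← PadicInt.padic_norm_e_of_padicInt x, ← PadicInt.padic_norm_e_of_padicInt y,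
    Padic.norm_eq_zpow_neg_valuation hx, Padic.norm_eq_zpow_neg_valuation hy, h]

/-- **(K₋₂) ∧ (P₋₂) ∧ (C₋₂), same index `e` ⇒ the blind certificate `L(−2) ≠ 0 ∧ ‖ξ(−2)‖₂ = ‖L(−2)‖₂`.**
Bookkeeping in valuations: `v(ξ(−2)) = e + v₂Tam + v₂#Sel = e + v₂(S) = v(L(−2))`.  Nothing asserted. [folklore] -/
theorem blindCertificate_of_package (D : SignedDatum W 2) {Wd : WeierstrassCurve ℚ} {S : ℚ} {e : ℕ}
    (htw : ∃ C : VariableChange ℚ, C • W.quadraticTwist 2 = Wd)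
    (hK : D.BlindEulerCharacteristicAt Wd e) (hP : D.BlindInterpolation S e)
    (hC : BlindDescentCertificate Wd S) :
    evalAt (-2 : ℤ_[2]) D.L ≠ 0 ∧ ‖evalAt (-2 : ℤ_[2]) D.xi‖ = ‖evalAt (-2 : ℤ_[2]) D.L‖ := by
  obtain ⟨hfin, hS0, hvS⟩ := hC
  obtain ⟨u, hu⟩ := hK htw hfin
  obtain ⟨u', hu'⟩ := hP
  have hS0' : ((S : ℚ) : ℚ_[2]) ≠ 0 := by exact_mod_cast hS0
  haveI : Finite (Wd.selmerGroupPInfty 2) := hfin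
  have hcardpos : 0 < Nat.card (Wd.selmerGroupPInfty 2) := Nat.card_pos
  have hcard : ((Nat.card (Wd.selmerGroupPInfty 2) : ℕ) : ℚ_[2]) ≠ 0 := by exact_mod_cast hcardpos.ne'
  -- rewrite the powers of `2` as casts of natural numbers (as the tree's `valuation_constantCoeff_xi` does)
  have hpe : ((2 : ℚ_[2]) ^ e) = ((2 ^ e : ℕ) : ℚ_[2]) := by norm_cast
  have hpT : ((2 : ℚ_[2]) ^ (padicValNat 2 Wd.tamagawaProduct)) =
      ((2 ^ (padicValNat 2 Wd.tamagawaProduct) : ℕ) : ℚ_[2]) := by norm_cast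
  have hpe0 : ((2 ^ e : ℕ) : ℚ_[2]) ≠ 0 := by exact_mod_cast pow_ne_zero _ two_ne_zero
  have hpT0 : ((2 ^ (padicValNat 2 Wd.tamagawaProduct) : ℕ) : ℚ_[2]) ≠ 0 := by
    exact_mod_cast pow_ne_zero _ two_ne_zero
  rw [hpe, hpT] at hu
  rw [hpe] at hu'
  have hLne : ((evalAt (-2 : ℤ_[2]) D.L : ℤ_[2]) : ℚ_[2]) ≠ 0 := by
    rw [hu']; exact mul_ne_zero (mul_ne_zero (coe_units_ne_zero 2 u') hpe0) hS0'
  have hxine : ((evalAt (-2 : ℤ_[2]) D.xi : ℤ_[2]) : ℚ_[2]) ≠ 0 := by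
    rw [hu]; exact mul_ne_zero (mul_ne_zero (mul_ne_zero (coe_units_ne_zero 2 u) hpe0) hpT0) hcard
  refine ⟨fun h0 => hLne (by rw [h0]; simp), norm_eq_norm_of_coe_valuation_eq hxine hLne ?_⟩
  -- valuations
  have hvL : (((evalAt (-2 : ℤ_[2]) D.L : ℤ_[2]) : ℚ_[2])).valuation = (e : ℤ) + padicValRat 2 S := by
    have h := congrArg Padic.valuation hu'
    rw [Padic.valuation_mul (mul_ne_zero (coe_units_ne_zero 2 u') hpe0) hS0',
      Padic.valuation_mul (coe_units_ne_zero 2 u') hpe0, valuation_coe_units_eq_zero,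
      Padic.valuation_natCast, padicValNat.prime_pow, Padic.valuation_ratCast] at h
    rw [h]; ring
  have hvxi : (((evalAt (-2 : ℤ_[2]) D.xi : ℤ_[2]) : ℚ_[2])).valuation =
      (e : ℤ) + (padicValNat 2 Wd.tamagawaProduct : ℤ) +
        (padicValNat 2 (Nat.card (Wd.selmerGroupPInfty 2)) : ℤ) := by
    have h := congrArg Padic.valuation hu
    rw [Padic.valuation_mul (mul_ne_zero (mul_ne_zero (coe_units_ne_zero 2 u) hpe0) hpT0) hcard,
      Padic.valuation_mul (mul_ne_zero (coe_units_ne_zero 2 u) hpe0) hpT0,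
      Padic.valuation_mul (coe_units_ne_zero 2 u) hpe0, valuation_coe_units_eq_zero,
      Padic.valuation_natCast, Padic.valuation_natCast, Padic.valuation_natCast, padicValNat.prime_pow,
      padicValNat.prime_pow] at h
    rw [h]; ring
  rw [hvxi, hvL, hvS]; ring

/-! ## §3. Assembly: ONE divisibility + the (α3)-package ⇒ `BSD(E,2)` in analytic rank `0` -/

open Literature.NumberTheory.EllipticCurves.Rank1Residual
  Literature.NumberTheory.EllipticCurves.Rank1Residual.Typed

/-- **R-L1-G10-B ASSEMBLY (`p = 2`, analytic rank `0`).**  For a signed Iwasawa datum `D = (ξ, L, c)` at `(E, 2)`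
with the tree's rank-0 readings at the TRIVIAL character — (K) `EulerCharacteristic`, (P) `Interpolation`, `2 ∤ c`
(the ♭-pair: `c♭ ∈ {1, −7, 1}`), `E[2]` irreducible (`E(ℚ)[2] = 0`, automatic at good supersingular `2`), GZK,
`L(E,1) ≠ 0` (ANALYTIC RANK 0 ONLY) — ONE divisibility of the signed main conjecture (either side) together with the
(α3)-PACKAGE at the ORDER-2 character — (K₋₂) for a `ℚ`-model `Wd` of `E^{(2)}`, (P₋₂) and the 2-descent certificate
(C₋₂), all with the same blind index `e` — gives Miller's `BSD(E,2)`.  Proof: §2 gives the blind certificate and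
`bsdp_two_of_oneDivisibility_of_blindCertificate` (p289031: the lever gives `(ξ) = (L)`, i.e. BOTH divisibilities,
and the tree's `missingLowerBoundAt_of_signedLowerDivisibility` / `missingUpperBoundAt_of_signedUpperDivisibility` /
`bsdp_of_missingPPartAt` conclude).  Composition only; nothing asserted.
[cite: RaySprung2025, §1.2 (p. 2343)] [cite: Kobayashi2003, §3 and Thm. 1.2] [cite: Miller2011LMS, Def. 1.1] -/
theorem bsdp_two_of_oneDivisibility_of_blindControl (W : WeierstrassCurve ℚ) [W.IsElliptic]
    [W.IsGloballyMinimal] (hGZK : rank_eq_analyticRank_of_analyticRank_le_one)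
    (hirr : W.HasIrreducibleModPGaloisRep 2) (hL : W.entireLFunction 1 ≠ 0) (D : SignedDatum W 2)
    (hc : ¬ 2 ∣ D.c) (hK : D.EulerCharacteristic) (hP : D.Interpolation)
    (hdiv : D.LowerDivisibility ∨ D.UpperDivisibility)
    {Wd : WeierstrassCurve ℚ} {S : ℚ} {e : ℕ}
    (htw : ∃ C : VariableChange ℚ, C • W.quadraticTwist 2 = Wd)
    (hKb : D.BlindEulerCharacteristicAt Wd e) (hPb : D.BlindInterpolation S e)
    (hCb : BlindDescentCertificate Wd S) : BSDp W 2 := by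
  obtain ⟨hcert0, hcert⟩ := blindCertificate_of_package D htw hKb hPb hCb
  exact bsdp_two_of_oneDivisibility_of_blindCertificate W hGZK hirr hL D hc hK hP hdiv hcert0 hcert

end Package

end BlindLever

end Summit.BirchSwinnertonDyer.Rank1Residual.Supersingular
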